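import Summits.SmoothPoincare4.SmoothPoincare4.Theses.SblfDescent
import Summits.SmoothPoincare4.SmoothPoincare4.Theorems.SblfDescentStepTwoReduction
import Summits.SmoothPoincare4.SmoothPoincare4.Theorems.SblfDescentRungOne
import Summits.SmoothPoincare4.SmoothPoincare4.Theorems.SblfDescentSblfExistsShield
import Summits.SmoothPoincare4.SmoothPoincare4.Theorems.StepTwo.Negative.SameMapObstruction
import Literature.Topology.FourManifolds.SimplifiedBrokenLefschetzFibration
import Literature.Topology.FourManifolds.GenusOneSblfOnSphereFourProofs
import Literature.Topology.FourManifolds.SphereFourFibredRegluing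

/-!
# F3 WITNESS / floor instantiation for line `fibred_regluing` (crux `SblfDescent.StepTwo`,
stmt-SmoothPoincare4-18529) — rung `TorusRegluingRecognition = FibredRegluingRecognition 1`.

Dial value `h = 0` of the family (`FibredRegluingRecognition 0`: Gluck regluing along a fibred sphere of a
genus-1 simplified broken Lefschetz fibration) follows from the route's floor item `RungOne`
(`fibredRegluingRecognition_zero_of_rungOne`, unconditional implication) and hence holds modulo the
published genus-one classification (`fibredRegluingRecognition_zero_of_fact`, named fact
`nonempty_diffeomorph_sphere_four_of_sblf_genus_one`, Hayano 2011 Cor. 4.11, through the tree theorem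
`RungOne_of_sblfGenusOne`).  In gluing language the `h = 0` regluing is PROVED outright in the tree:
`Literature.Topology.FourManifolds.nonempty_diffeomorph_sphere_four_of_isBoundaryGluing_fibred`
(`SphereFourFibredRegluing.lean`).  The definitions are those of `Lines/fibred_regluing.lean`, verbatim
(this file must elaborate on its own).  No `sorry`.
-/

set_option linter.dupNamespace false

namespace Summit.SmoothPoincare4.SmoothPoincare4.Cruxes.StepTwo.FibredRegluing

open scoped Manifold ContDiff Topology ContinuousMap
open Literature.Topology.FourManifolds
open Summit.SmoothPoincare4.SmoothPoincare4.Theses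
open Summit.SmoothPoincare4.SmoothPoincare4.Theorems

/-- Local notation: the round spheres `S⁴ ⊂ ℝ⁵`, `S² ⊂ ℝ³`. -/
local notation "𝕊⁴" => Metric.sphere (0 : EuclideanSpace ℝ (Fin 5)) 1
local notation "𝕊²" => Metric.sphere (0 : EuclideanSpace ℝ (Fin 3)) 1

/-- `y` is a LOWER regular value of `f` (lower genus `h`): every point over `y` is regular and the fibre
has `H₁ ≅ ℤ^{2h}` — verbatim the clause of `IsSimplifiedBrokenLefschetzFibration.exists_lower`. -/
def IsLowerRegularValue {X : Type} [TopologicalSpace X] [ChartedSpace (EuclideanSpace ℝ (Fin 4)) X]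
    (f : X → 𝕊²) (h : ℕ) (y : 𝕊²) : Prop :=
  (∀ q, f q = y → Function.Surjective (mfderiv (𝓡 4) (𝓡 2) f q)) ∧
    Nonempty ((Fin (2 * h) → ℤ) ≃ₗ[ℤ]
      Literature.AlgebraicTopology.SingularHomology.singularHomology ℤ ℤ ↥(f ⁻¹' {y}) 1)

/-- FIBRED AGREEMENT OFF THE FIBRE OVER `y₀`: `Ψ` is a diffeomorphism from `X ∖ f⁻¹{y₀}` onto
`Y ∖ f₀⁻¹{y₀}` with `f₀ ∘ Ψ = f` there.  ("`(X, f)` is `(Y, f₀)` reglued along the fibre over `y₀`.") -/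
def IsFibredAgreementOff {X Y : Type} [TopologicalSpace X] [ChartedSpace (EuclideanSpace ℝ (Fin 4)) X]
    [TopologicalSpace Y] [ChartedSpace (EuclideanSpace ℝ (Fin 4)) Y]
    (f : X → 𝕊²) (f₀ : Y → 𝕊²) (y₀ : 𝕊²) (Ψ : OpenPartialHomeomorph X Y) : Prop :=
  Ψ.source = (f ⁻¹' {y₀})ᶜ ∧ Ψ.target = (f₀ ⁻¹' {y₀})ᶜ ∧
    ContMDiffOn (𝓡 4) (𝓡 4) ∞ Ψ Ψ.source ∧ ContMDiffOn (𝓡 4) (𝓡 4) ∞ Ψ.symm Ψ.target ∧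
    ∀ x ∈ Ψ.source, f₀ (Ψ x) = f x

/-- RUNG FAMILY (gluing-genus dial, recognition form): a smooth homotopy 4-sphere `X` carrying a
simplified broken Lefschetz fibration `f` of lower genus `h` which agrees, off the fibre over a
lower-regular value `y₀`, with a simplified broken Lefschetz fibration `f₀` of lower genus `h` of the
ROUND sphere, is diffeomorphic to `S⁴`.  `h = 0` ⟸ `RungOne` (`fibredRegluingRecognition_zero_of_rungOne`);
`h ≥ 2`: in print (Baykur–Hayano Thm. 3.9: the Hurwitz systems agree, `Diff₀(Σ_h)` contractible);
`h = 1` = `TorusRegluingRecognition`, THE RUNG. -/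
def FibredRegluingRecognition (h : ℕ) : Prop :=
  ∀ (X : Type) [TopologicalSpace X] [T2Space X] [SecondCountableTopology X]
    [ChartedSpace (EuclideanSpace ℝ (Fin 4)) X] [IsManifold (𝓡 4) ((⊤ : ℕ∞) : WithTop ℕ∞) X],
    X ≃ₕ 𝕊⁴ →
    ∀ f : X → 𝕊², (∃ (o : SmoothOrientation (𝓡 4) X) (L : Finset X),
      IsSimplifiedBrokenLefschetzFibration o f L h) →
    ∀ f₀ : 𝕊⁴ → 𝕊², (∃ (o₀ : SmoothOrientation (𝓡 4) 𝕊⁴) (L₀ : Finset 𝕊⁴),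
      IsSimplifiedBrokenLefschetzFibration o₀ f₀ L₀ h) →
    ∀ y₀ : 𝕊², IsLowerRegularValue f h y₀ →
    ∀ Ψ : OpenPartialHomeomorph X 𝕊⁴, IsFibredAgreementOff f f₀ y₀ Ψ →
    Nonempty (Diffeomorph (𝓡 4) (𝓡 4) X 𝕊⁴ ((⊤ : ℕ∞) : WithTop ℕ∞))

/-- THE RUNG (`h = 1`): a homotopy 4-sphere obtained from a genus-2 simplified broken Lefschetz
fibration of `S⁴` by one fibred regluing of the lower side `T² × D²` — i.e. by ONE multiplicity-one
logarithmic transformation along a lower torus fibre — is `S⁴`.  (For every direction `(a,b)`: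
directions changing the homotopy type are excluded by the hypothesis `X ≃ₕ S⁴`.) -/
def TorusRegluingRecognition : Prop := FibredRegluingRecognition 1

/-- GAP FAMILY: every simplified broken Lefschetz fibration of lower genus `h` on a smooth homotopy
4-sphere is a fibred regluing, along the fibre over one of ITS lower-regular values, of a simplified
broken Lefschetz fibration of lower genus `h` of the round `S⁴`.  (A consequence of the summit by
transport — `regluingOfSphereFour_of_recognition`; as a statement short of it: a census of genus-`(h+1)`
Hurwitz systems of homotopy spheres — all realised on `S⁴` — plus Baykur–Hayano-type uniqueness of the
higher side and round cobordism.) -/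
def RegluingOfSphereFour (h : ℕ) : Prop :=
  ∀ (X : Type) [TopologicalSpace X] [T2Space X] [SecondCountableTopology X]
    [ChartedSpace (EuclideanSpace ℝ (Fin 4)) X] [IsManifold (𝓡 4) ((⊤ : ℕ∞) : WithTop ℕ∞) X],
    X ≃ₕ 𝕊⁴ →
    ∀ f : X → 𝕊², (∃ (o : SmoothOrientation (𝓡 4) X) (L : Finset X),
      IsSimplifiedBrokenLefschetzFibration o f L h) →
    ∃ f₀ : 𝕊⁴ → 𝕊², (∃ (o₀ : SmoothOrientation (𝓡 4) 𝕊⁴) (L₀ : Finset 𝕊⁴),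
      IsSimplifiedBrokenLefschetzFibration o₀ f₀ L₀ h) ∧
      ∃ y₀ : 𝕊², IsLowerRegularValue f h y₀ ∧
        ∃ Ψ : OpenPartialHomeomorph X 𝕊⁴, IsFibredAgreementOff f f₀ y₀ Ψ

/-- THE GAP at `h = 1` (to `StepTwo`): every genus-2 simplified broken Lefschetz fibration on a homotopy
4-sphere is a fibred torus regluing (one multiplicity-one log transform along a lower torus fibre) of a
genus-2 simplified broken Lefschetz fibration of `S⁴`. -/
def TorusRegluingOfSphereFour : Prop := RegluingOfSphereFour 1

/-- F3 (instantiation): dial value `h = 0` follows from the route's floor item `RungOne`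
(the regluing data are discarded). [this file] -/
theorem fibredRegluingRecognition_zero_of_rungOne (h1 : SblfDescent.RungOne) :
    FibredRegluingRecognition 0 := by
  intro X _ _ _ _ _ e f hf _ _ _ _ _ _
  obtain ⟨o, L, hf⟩ := hf
  exact h1 X e ((sblfDescent_has_zero_iff X).mp ⟨o, f, L, hf⟩)

/-- F3 WITNESS: `FibredRegluingRecognition 0` modulo the published genus-one classification.
[cite: Hayano2011, Cor. 4.11] -/
theorem fibredRegluingRecognition_zero_of_fact
    (H : nonempty_diffeomorph_sphere_four_of_sblf_genus_one) : FibredRegluingRecognition 0 :=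
  fibredRegluingRecognition_zero_of_rungOne (RungOne_of_sblfGenusOne H)

/-- The witness as an `example` in the F3 shape. -/
example (H : nonempty_diffeomorph_sphere_four_of_sblf_genus_one) : FibredRegluingRecognition 0 :=
  fibredRegluingRecognition_zero_of_fact H

/-- TRANSPORT: if every homotopy 4-sphere carrying a lower-genus-`h` SBLF is diffeomorphic to `S⁴`,
then every such SBLF is a fibred regluing of its own transport to `S⁴` (`Ψ` = the diffeomorphism
restricted off the fibre).  Gives the on-path lemma for the gap and its necessity for `StepTwo`. [this file] -/
theorem regluingOfSphereFour_of_recognition (h : ℕ)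
    (hR : ∀ (X : Type) [TopologicalSpace X] [T2Space X] [SecondCountableTopology X]
      [ChartedSpace (EuclideanSpace ℝ (Fin 4)) X] [IsManifold (𝓡 4) ((⊤ : ℕ∞) : WithTop ℕ∞) X],
      X ≃ₕ 𝕊⁴ →
      (∃ (o : SmoothOrientation (𝓡 4) X) (f : X → 𝕊²) (L : Finset X),
          IsSimplifiedBrokenLefschetzFibration o f L h) →
      Nonempty (Diffeomorph (𝓡 4) (𝓡 4) X 𝕊⁴ ((⊤ : ℕ∞) : WithTop ℕ∞))) :
    RegluingOfSphereFour h := by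
  intro X _ _ _ _ _ e f hf
  obtain ⟨o, L, hf⟩ := hf
  obtain ⟨Φ⟩ := hR X e ⟨o, f, L, hf⟩
  obtain ⟨y₀, hy₀⟩ := hf.exists_lower
  have hcont : Continuous f := hf.contMDiff.continuous
  have hopen : IsOpen (f ⁻¹' {y₀})ᶜ := ((isClosed_singleton).preimage hcont).isOpen_compl
  have hcont₀ : Continuous (f ∘ Φ.symm) := hcont.comp Φ.symm.continuous
  have hopen₀ : IsOpen ((f ∘ Φ.symm) ⁻¹' {y₀})ᶜ := ((isClosed_singleton).preimage hcont₀).isOpen_compl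
  let Ψ : OpenPartialHomeomorph X 𝕊⁴ :=
    { toFun := Φ
      invFun := Φ.symm
      source := (f ⁻¹' {y₀})ᶜ
      target := ((f ∘ Φ.symm) ⁻¹' {y₀})ᶜ
      map_source' := by
        intro x hx
        simpa [Set.mem_compl_iff, Set.mem_preimage, Function.comp, Diffeomorph.symm_apply_apply] using hx
      map_target' := by
        intro y hy
        simpa [Set.mem_compl_iff, Set.mem_preimage, Function.comp] using hy
      left_inv' := by intro x _; simp
      right_inv' := by intro y _; simp
      open_source := hopen
      open_target := hopen₀
      continuousOn_toFun := Φ.continuous.continuousOn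
      continuousOn_invFun := Φ.symm.continuous.continuousOn }
  refine ⟨f ∘ Φ.symm, ⟨_, _, sblf_comp_diffeomorph Φ.symm hf⟩, y₀, hy₀, Ψ, rfl, rfl, ?_, ?_, ?_⟩
  · exact Φ.contMDiff.contMDiffOn
  · exact Φ.symm.contMDiff.contMDiffOn
  · intro x _
    show f (Φ.symm (Φ x)) = f x
    simp

/-- F3 for the GAP family: dial value `h = 0` of `RegluingOfSphereFour` (every genus-1 simplified broken
Lefschetz fibration on a homotopy 4-sphere is a fibred sphere regluing of one on `S⁴`) follows from the route's
floor item `RungOne` by transport. [this file] -/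
theorem regluingOfSphereFour_zero_of_rungOne (h1 : SblfDescent.RungOne) : RegluingOfSphereFour 0 :=
  regluingOfSphereFour_of_recognition 0
    (fun X _ _ _ _ _ e hX => h1 X e ((sblfDescent_has_zero_iff X).mp hX))

/-- F3 for the GAP family modulo the published genus-one classification. [cite: Hayano2011, Cor. 4.11] -/
theorem regluingOfSphereFour_zero_of_fact
    (H : nonempty_diffeomorph_sphere_four_of_sblf_genus_one) : RegluingOfSphereFour 0 :=
  regluingOfSphereFour_zero_of_rungOne (RungOne_of_sblfGenusOne H)

end Summit.SmoothPoincare4.SmoothPoincare4.Cruxes.StepTwo.FibredRegluing
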